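import Summits.ResolutionOfSingularities.KangarooAtlas.MizutaniExpandShift
import Summits.ResolutionOfSingularities.KangarooAtlas.MizutaniCoordChange
import HarnessLib

/-!
# The Frobenius image of a subgroup scheme cut out by additive forms — II: transport, all families, all `m`; linear points

Cell `pub-rosobs`, Mizutani enclosure (seat mizutani-encloser-2, gen 9). AI-written; *AI review is weaker than expert
review*; NOT a resolution-of-singularities theorem (summit relevance C).

Sequel to `MizutaniExpandShift.lean` (Mizutani 1973 Lemma 2.7 for points; end node `MizutaniFrobeniusImage.lean`):

* `aeval_linForm_comp`, `aeval_linForm_one`, **`aeval_linForm_comp_expand`** (`σ_M ∘ F = F ∘ σ_{M^{[p]}}` for the projective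
  coordinate change `σ_M : X_j ↦ Σ_l M_{jl} X_l` of `MizutaniCoordChange`), `map_aeval_linForm_famIdeal` (`σ_M` of `famIdeal N`
  is `famIdeal` of the family twisted by the `M^{[p^e]}`), `frobVec_mem_twist` (the twisted family is `F`-stable);
* `comap_expand_famIdeal_le_of_twist` — transport of the engine inequality along `σ_M`, `M` invertible;
* **`comap_expand_famIdeal_le`**, **`comap_expand_pow_famIdeal`** — for EVERY `F`-stable levelwise family `N` and every `m`:
  `(famIdeal N).comap (expand p^m) = famIdeal (j ↦ N (j+m))` (a basis of `k^{n+1}` adapted to `N 0`, `exists_basis_adapted`,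
  makes the twisted family coordinate-saturated; induction on `m`);
* linear points: **`pointForms_span_linForm`** (`{a : Σ a_i X_i^{p^j} ∈ (Σ v_i X_i : v ∈ N)} = span_k F^j(N)`, by evaluation at
  the `k`-points of `N^⊥`), `linForm_mem_span_linForm_iff`, **`invForms_span_linForm`** (`(L_B)_j = span_k F^j(N)`, with
  encloser-1's `exponentLE_comap_span_linForm` at `e = 0`).

## References

* H. Mizutani, *Hironaka's additive group schemes*, Nagoya Math. J. 52 (1973) 85–95, Lemma 2.7 (p. 89–90). [Mizutani1973HironakaGroupSchemes]
* T. Oda, *Hironaka's additive group scheme, II*, Publ. RIMS 19 (1983), §2 (p. 1168: `L_e`, `L_B`, the `k[F]`-module structure). [Oda1983HironakaGroupSchemeII]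
-/

noncomputable section

open MvPolynomial Literature.AlgebraicGeometry.Resolution Literature.AlgebraicGeometry.Resolution.HironakaScheme
  Literature.RingTheory.MvPolynomial

namespace Summit.ResolutionOfSingularities.KangarooAtlas.Mizutani

universe u

section Family

variable (k : Type u) [Field k] (p : ℕ) [hp : Fact p.Prime] [CharP k p] {n : ℕ}
  (N : ℕ → Submodule k (Fin (n + 1) → k))

/-! ### Transport along a projective coordinate change -/

omit hp [CharP k p] in
/-- `σ_A` on linear forms: `σ_A (Σ v_j X_j) = Σ_l (v ᵥ* A)_l X_l`. [folklore] -/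
theorem aeval_linForm_linForm (A : Matrix (Fin (n + 1)) (Fin (n + 1)) k) (v : Fin (n + 1) → k) :
    aeval (fun j => linForm (A j)) (linForm v) = linForm (Matrix.vecMul v A) := by
  rw [linForm_apply, map_sum, Matrix.vecMul_eq_sum, map_sum]
  refine Finset.sum_congr rfl fun j _ => ?_
  rw [map_smul, aeval_X, map_smul]

omit hp [CharP k p] in
/-- Composition of coordinate changes: `σ_A ∘ σ_C = σ_{C·A}`. [folklore] -/
theorem aeval_linForm_comp (A C : Matrix (Fin (n + 1)) (Fin (n + 1)) k) :
    (aeval fun j => linForm (A j)).comp (aeval fun j => linForm (C j)) =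
      aeval fun j => linForm (K := k) ((C * A) j) := by
  refine MvPolynomial.algHom_ext fun j => ?_
  rw [AlgHom.comp_apply, aeval_X, aeval_X, aeval_linForm_linForm]
  rfl

omit hp [CharP k p] in
/-- `σ_1 = id`. [folklore] -/
theorem aeval_linForm_one :
    (aeval fun j => linForm (K := k) ((1 : Matrix (Fin (n + 1)) (Fin (n + 1)) k) j)) = AlgHom.id k _ := by
  refine MvPolynomial.algHom_ext fun j => ?_
  rw [aeval_X, AlgHom.id_apply]
  have h : ((1 : Matrix (Fin (n + 1)) (Fin (n + 1)) k) j) = Pi.single j 1 :=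
    funext fun l => Matrix.one_eq_pi_single
  rw [h, linForm_single]

/-- **`σ_M ∘ F = F ∘ σ_{M^{[q]}}`**: `σ_M (g(X^q)) = (σ_{M^{[q]}} g)(X^q)` (`(Σ_l M_{jl} X_l)^q = Σ_l M_{jl}^q X_l^q`).
[cite: Mizutani1973HironakaGroupSchemes, Lemma 2.7] -/
theorem aeval_linForm_comp_expand (M : Matrix (Fin (n + 1)) (Fin (n + 1)) k) (e : ℕ) :
    (aeval fun j => linForm (M j)).comp
        (expand (p ^ e) : MvPolynomial (Fin (n + 1)) k →ₐ[k] MvPolynomial (Fin (n + 1)) k) =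
      (expand (p ^ e) : MvPolynomial (Fin (n + 1)) k →ₐ[k] MvPolynomial (Fin (n + 1)) k).comp
        (aeval fun j => linForm ((M.map fun x => x ^ p ^ e) j)) := by
  refine MvPolynomial.algHom_ext fun j => ?_
  rw [AlgHom.comp_apply, AlgHom.comp_apply, expand_X, map_pow, aeval_X, aeval_X, linForm_pow_char_pow,
    expand_linForm]
  rfl

/-- The family twisted by `M`: level `e` is the image of `N e` under `a ↦ a ᵥ* M^{[p^e]}` — the coefficient vectors of
`σ_M` of the additive forms of `N` (`aeval_linForm_addForm`); it is `F`-stable when `N` is. [folklore] -/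
theorem frobVec_mem_twist (hF : ∀ e m, ∀ a ∈ N e, frobVec k p m a ∈ N (e + m))
    (M : Matrix (Fin (n + 1)) (Fin (n + 1)) k) :
    ∀ e m, ∀ a ∈ (N e).map (Matrix.vecMulLinear (M.map fun x => x ^ p ^ e)),
      frobVec k p m a ∈ (N (e + m)).map (Matrix.vecMulLinear (M.map fun x => x ^ p ^ (e + m))) := by
  rintro e m _ ⟨a, ha, rfl⟩
  refine ⟨frobVec k p m a, hF e m a ha, ?_⟩
  show Matrix.vecMul (frobVec k p m a) _ = frobVec k p m (Matrix.vecMul a _)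
  rw [frobVec_vecMul]

/-- `σ_M (famIdeal N) = famIdeal (N twisted by M)`. [cite: Oda1983HironakaGroupSchemeII, §2 (p. 1168: L_e)] -/
theorem map_aeval_linForm_famIdeal (M : Matrix (Fin (n + 1)) (Fin (n + 1)) k) :
    (famIdeal k p N).map (aeval fun j => linForm (M j)) =
      famIdeal k p (fun e => (N e).map (Matrix.vecMulLinear (M.map fun x => x ^ p ^ e))) := by
  unfold famIdeal
  rw [Ideal.map_span]
  congr 1
  ext f
  simp only [Set.mem_image, Set.mem_iUnion, SetLike.mem_coe, Submodule.mem_map]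
  constructor
  · rintro ⟨_, ⟨e, a, ha, rfl⟩, rfl⟩
    exact ⟨e, _, ⟨a, ha, rfl⟩, (aeval_linForm_addForm k p M e a).symm⟩
  · rintro ⟨e, _, ⟨a, ha, rfl⟩, rfl⟩
    exact ⟨_, ⟨e, a, ha, rfl⟩, aeval_linForm_addForm k p M e a⟩

omit hp [CharP k p] in
/-- `(M^{[p^a]})^{[p^b]} = M^{[p^{a+b}]}`. [folklore] -/
theorem map_pow_map_pow (M : Matrix (Fin (n + 1)) (Fin (n + 1)) k) (a b : ℕ) :
    (M.map fun x => x ^ p ^ a).map (fun x => x ^ p ^ b) = M.map fun x => x ^ p ^ (a + b) := by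
  ext i j
  simp only [Matrix.map_apply, ← pow_mul, ← pow_add]

/-- `(A·B)^{[q]} = A^{[q]}·B^{[q]}` (Frobenius is a ring homomorphism). [folklore] -/
theorem map_pow_mul (A B : Matrix (Fin (n + 1)) (Fin (n + 1)) k) (e : ℕ) :
    (A * B).map (fun x => x ^ p ^ e) = A.map (fun x => x ^ p ^ e) * B.map (fun x => x ^ p ^ e) := by
  have h : (fun x : k => x ^ p ^ e) = ⇑(iterateFrobenius k p e) := funext fun x => (iterateFrobenius_def p e x).symm
  rw [h]
  exact Matrix.map_mul

omit [CharP k p] in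
/-- `1^{[q]} = 1`. [folklore] -/
theorem one_map_pow (e : ℕ) : (1 : Matrix (Fin (n + 1)) (Fin (n + 1)) k).map (fun x => x ^ p ^ e) = 1 :=
  Matrix.map_one _ (zero_pow (pow_ne_zero _ hp.out.ne_zero)) (one_pow _)

variable {N}

/-- **TRANSPORT**: if the engine inequality holds for the family twisted by an invertible `M`, it holds for `N`
(`σ_M` turns `g(X^p) ∈ famIdeal N` into `(σ_{M^{[p]}} g)(X^p) ∈ famIdeal N^M`, and `σ_{(M^{[p]})⁻¹}` brings the shifted
family back). [cite: Mizutani1973HironakaGroupSchemes, Lemma 2.7] -/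
theorem comap_expand_famIdeal_le_of_twist {M : Matrix (Fin (n + 1)) (Fin (n + 1)) k} (hM : IsUnit M.det)
    (h : (famIdeal k p (fun e => (N e).map (Matrix.vecMulLinear (M.map fun x => x ^ p ^ e)))).comap
        (expand p : MvPolynomial (Fin (n + 1)) k →ₐ[k] MvPolynomial (Fin (n + 1)) k) ≤
      famIdeal k p (fun j => (N (j + 1)).map (Matrix.vecMulLinear (M.map fun x => x ^ p ^ (j + 1))))) :
    (famIdeal k p N).comap (expand p : MvPolynomial (Fin (n + 1)) k →ₐ[k] MvPolynomial (Fin (n + 1)) k) ≤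
      famIdeal k p (fun j => N (j + 1)) := by
  intro g hg
  rw [Ideal.mem_comap] at hg
  -- work with `expand (p^1)`
  have hg1 : expand (p ^ 1) g ∈ famIdeal k p N := by rwa [pow_one]
  set M₁ := M.map fun x => x ^ p ^ 1 with hM₁
  have hM₁u : IsUnit M₁.det := isUnit_det_map_pow k p hM 1
  -- `σ_M (g(X^p)) = (σ_{M₁} g)(X^p) ∈ famIdeal N^M`
  have h1 : aeval (fun j => linForm (M j)) (expand (p ^ 1) g) ∈
      famIdeal k p (fun e => (N e).map (Matrix.vecMulLinear (M.map fun x => x ^ p ^ e))) := by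
    rw [← map_aeval_linForm_famIdeal]
    exact Ideal.mem_map_of_mem _ hg1
  have hcomm : aeval (fun j => linForm (M j)) (expand (p ^ 1) g) =
      expand (p ^ 1) (aeval (fun j => linForm (M₁ j)) g) :=
    congrArg (fun φ : MvPolynomial (Fin (n + 1)) k →ₐ[k] MvPolynomial (Fin (n + 1)) k => φ g)
      (aeval_linForm_comp_expand k p M 1)
  rw [hcomm, pow_one] at h1
  have h2 : aeval (fun j => linForm (M₁ j)) g ∈
      famIdeal k p (fun j => (N (j + 1)).map (Matrix.vecMulLinear (M.map fun x => x ^ p ^ (j + 1)))) :=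
    h (Ideal.mem_comap.mpr h1)
  -- apply `σ_{M₁⁻¹}`
  have hinv : M₁ * M₁⁻¹ = 1 := Matrix.mul_nonsing_inv M₁ hM₁u
  have hback : aeval (fun j => linForm (M₁⁻¹ j)) (aeval (fun j => linForm (M₁ j)) g) = g := by
    rw [← AlgHom.comp_apply, aeval_linForm_comp, hinv, aeval_linForm_one, AlgHom.id_apply]
  rw [← hback]
  have h3 := Ideal.mem_map_of_mem (aeval fun j => linForm (M₁⁻¹ j)) h2
  rw [map_aeval_linForm_famIdeal] at h3
  unfold famIdeal at h3 ⊢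
  refine (Ideal.span_mono (Set.iUnion_mono fun j => ?_)) h3
  rintro _ ⟨_, ⟨_, ⟨a, ha, rfl⟩, rfl⟩, rfl⟩
  refine ⟨a, ha, ?_⟩
  have hMj : M.map (fun x => x ^ p ^ (j + 1)) = M₁.map (fun x => x ^ p ^ j) := by
    rw [hM₁, map_pow_map_pow, Nat.add_comm 1 j]
  show addForm k p j a = addForm k p j (Matrix.vecMul (Matrix.vecMul a (M.map fun x => x ^ p ^ (j + 1)))
    (M₁⁻¹.map fun x => x ^ p ^ j))
  rw [Matrix.vecMul_vecMul, hMj, ← map_pow_mul, hinv, one_map_pow, Matrix.vecMul_one]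

/-- **THE ENGINE** (`m = 1`): for every `F`-stable levelwise family `N` of subspaces of `k^{n+1}`,
`(famIdeal N).comap (expand p) ≤ famIdeal (j ↦ N (j+1))` — transport of the coordinate case along the coordinate change
attached to a basis of `k^{n+1}` adapted to the linear forms `N 0`. [cite: Mizutani1973HironakaGroupSchemes, Lemma 2.7] -/
theorem comap_expand_famIdeal_le (hF : ∀ e m, ∀ a ∈ N e, frobVec k p m a ∈ N (e + m)) :
    (famIdeal k p N).comap (expand p : MvPolynomial (Fin (n + 1)) k →ₐ[k] MvPolynomial (Fin (n + 1)) k) ≤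
      famIdeal k p (fun j => N (j + 1)) := by
  classical
  obtain ⟨b, J, _J₂, hJ, -⟩ := exists_basis_adapted (N 0) ⊥
  -- the matrix of `σ`: row `i` = the coordinates of `e_i` in the basis `b`
  set M : Matrix (Fin (n + 1)) (Fin (n + 1)) k := Matrix.of fun i j => b.repr (Pi.single i 1) j with hM
  have hvec : ∀ v : Fin (n + 1) → k, Matrix.vecMul v M = ⇑(b.repr v) := by
    intro v
    have key : (Matrix.vecMulLinear M : (Fin (n + 1) → k) →ₗ[k] (Fin (n + 1) → k)) =
        Finsupp.lcoeFun ∘ₗ (b.repr : (Fin (n + 1) → k) →ₗ[k] (Fin (n + 1) →₀ k)) := by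
      refine (Pi.basisFun k (Fin (n + 1))).ext fun i => ?_
      rw [Pi.basisFun_apply, LinearMap.comp_apply, Matrix.vecMulLinear_apply, Matrix.single_one_vecMul]
      rfl
    exact congrArg (fun f : (Fin (n + 1) → k) →ₗ[k] (Fin (n + 1) → k) => f v) key
  -- `M` is invertible: the matrix of the `b j` is a left inverse
  have hBM : (Matrix.of fun j i => b j i) * M = 1 := by
    ext j l
    have h := congrFun (hvec (b j)) l
    rw [b.repr_self, Finsupp.single_eq_pi_single] at h
    rw [Matrix.mul_apply, Matrix.one_eq_pi_single, ← h]
    rfl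
  have hMdet : IsUnit M.det := Matrix.isUnit_det_of_left_inverse hBM
  have hM0 : M.map (fun x => x ^ p ^ 0) = M := by
    ext i j
    rw [Matrix.map_apply, pow_zero, pow_one]
  -- the twisted family is coordinate-saturated
  have hT : ∀ a ∈ (fun e => (N e).map (Matrix.vecMulLinear (M.map fun x => x ^ p ^ e))) 0, ∀ i, a i ≠ 0 →
      (Pi.single i 1 : Fin (n + 1) → k) ∈
        (fun e => (N e).map (Matrix.vecMulLinear (M.map fun x => x ^ p ^ e))) 1 := by
    rintro _ ⟨v, hv, rfl⟩ i hi
    have hv : v ∈ N 0 := hv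
    have hi' : b.repr v i ≠ 0 := by
      have h : Matrix.vecMulLinear (M.map fun x => x ^ p ^ 0) v = ⇑(b.repr v) := by
        rw [Matrix.vecMulLinear_apply, hM0, hvec]
      rw [h] at hi
      exact hi
    have hiJ : i ∈ J := by
      rw [← hJ] at hv
      exact Finset.mem_coe.mp (b.repr_support_subset_of_mem_span (↑J) hv (Finsupp.mem_support_iff.mpr hi'))
    have hbi : b i ∈ N 0 := by
      rw [← hJ]
      exact Submodule.subset_span ⟨i, Finset.mem_coe.mpr hiJ, rfl⟩
    have he0 : (Pi.single i 1 : Fin (n + 1) → k) ∈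
        (N 0).map (Matrix.vecMulLinear (M.map fun x => x ^ p ^ 0)) := by
      refine ⟨b i, hbi, ?_⟩
      rw [Matrix.vecMulLinear_apply, hM0, hvec, b.repr_self, Finsupp.single_eq_pi_single]
    have h1 := frobVec_mem_twist k p N hF M 0 1 _ he0
    rw [frobVec_single, Nat.zero_add] at h1
    exact h1
  exact comap_expand_famIdeal_le_of_twist k p hMdet
    (comap_expand_famIdeal_le_of_coord k p
      (N := fun e => (N e).map (Matrix.vecMulLinear (M.map fun x => x ^ p ^ e))) hT)

/-- **`(famIdeal N).comap (expand p^m) = famIdeal (j ↦ N (j+m))`** for every `F`-stable levelwise family `N` and every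
`m`: the Frobenius image `F^m(V(famIdeal N))` is cut out by the shifted family. [cite: Mizutani1973HironakaGroupSchemes, Lemma 2.7] -/
theorem comap_expand_pow_famIdeal (hF : ∀ e m, ∀ a ∈ N e, frobVec k p m a ∈ N (e + m)) (m : ℕ) :
    (famIdeal k p N).comap (expand (p ^ m) : MvPolynomial (Fin (n + 1)) k →ₐ[k] MvPolynomial (Fin (n + 1)) k) =
      famIdeal k p (fun j => N (j + m)) := by
  induction m generalizing N with
  | zero =>
    ext g
    rw [Ideal.mem_comap, pow_zero, expand_one_apply]
    exact Iff.rfl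
  | succ m ih =>
    refine le_antisymm ?_ (famIdeal_shift_le_comap_expand k p N (m + 1))
    intro g hg
    rw [Ideal.mem_comap, pow_succ', expand_mul] at hg
    have h1 : expand (p ^ m) g ∈ famIdeal k p (fun j => N (j + 1)) :=
      comap_expand_famIdeal_le k p hF (Ideal.mem_comap.mpr hg)
    have hF' : ∀ e m', ∀ a ∈ (fun j => N (j + 1)) e, frobVec k p m' a ∈ (fun j => N (j + 1)) (e + m') := by
      intro e m' a ha
      have h := hF (e + 1) m' a ha
      rwa [Nat.add_right_comm] at h
    have h2 : g ∈ famIdeal k p (fun j => (fun j => N (j + 1)) (j + m)) := by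
      rw [← ih hF']
      exact Ideal.mem_comap.mpr h1
    simpa only [Nat.add_assoc, Nat.add_comm 1 m] using h2

end Family

/-! ## Linear points: the additive forms of `(Σ v_i X_i : v ∈ N)` -/

section Linear

variable (k : Type u) [Field k] (p : ℕ) [hp : Fact p.Prime] [CharP k p] {n : ℕ}

/-- **The additive forms of level `j` in the ideal of the linear forms of `N` are `k·F^j(N)`**:
`{a : Σ a_i X_i^{p^j} ∈ (Σ v_i X_i : v ∈ N)} = span_k F^j(N)` (`⊇`: `(Σ v_i X_i)^{p^j}`; `⊆`: evaluate at the `k`-points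
of `N^⊥` and count dimensions). [cite: Oda1983HironakaGroupSchemeII, §2 (p. 1168: kF^{j}Q_0)] -/
theorem pointForms_span_linForm (N : Submodule k (Fin (n + 1) → k)) (j : ℕ) :
    pointForms k p (Ideal.span (linForm '' (N : Set (Fin (n + 1) → k)))) j =
      Submodule.span k (frobVec k p j '' (N : Set (Fin (n + 1) → k))) := by
  set 𝔩 : Ideal (MvPolynomial (Fin (n + 1)) k) := Ideal.span (linForm '' (N : Set (Fin (n + 1) → k))) with h𝔩
  obtain ⟨d, lam, hlam, hdN, horth⟩ := exists_orth_family k N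
  have hlow : Submodule.span k (frobVec k p j '' (N : Set (Fin (n + 1) → k))) ≤ pointForms k p 𝔩 j := by
    rw [Submodule.span_le]
    rintro _ ⟨g, hg, rfl⟩
    rw [SetLike.mem_coe, mem_pointForms_iff]
    have hpow : addForm k p j (frobVec k p j g) = linForm g ^ p ^ j := by
      rw [linForm_eq_addForm_zero k p, addForm_pow_pow, Nat.zero_add]
    rw [hpow]
    exact Ideal.pow_mem_of_mem 𝔩 (Ideal.subset_span ⟨g, hg, rfl⟩) _ (pow_pos hp.out.pos _)
  have heval : ∀ l, ∀ f ∈ 𝔩, eval (lam l) f = 0 := by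
    intro l
    have hle : 𝔩 ≤ RingHom.ker (eval (lam l) : MvPolynomial (Fin (n + 1)) k →+* k) := by
      rw [h𝔩, Ideal.span_le]
      rintro _ ⟨g, hg, rfl⟩
      rw [SetLike.mem_coe, RingHom.mem_ker, linForm_eq_addForm_zero k p, eval_addForm]
      simp only [pow_zero, pow_one]
      exact horth g hg l
    intro f hf
    exact hle hf
  have hup : pointForms k p 𝔩 j ≤ LinearMap.ker (Matrix.of (fun l => frobVec k p j (lam l))).mulVecLin := by
    intro g hg
    rw [mem_ker_mulVecLin_iff]
    intro l
    rw [mem_pointForms_iff] at hg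
    have h0 := heval l _ hg
    rw [eval_addForm] at h0
    rw [← h0]
    exact Finset.sum_congr rfl fun i _ => mul_comm _ _
  haveI : FiniteDimensional k (pointForms k p 𝔩 j) := FiniteDimensional.finiteDimensional_submodule _
  have hker := finrank_ker_mulVecLin_of_linearIndependent k _ (linearIndependent_frobVec k p j lam hlam)
  have h1 : Module.finrank k (pointForms k p 𝔩 j) ≤ n + 1 - d := hker ▸ Submodule.finrank_mono hup
  have h2 : Module.finrank k (Submodule.span k (frobVec k p j '' (N : Set (Fin (n + 1) → k)))) = n + 1 - d := by
    rw [finrank_span_frobVec_image k p j N]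
    omega
  exact (Submodule.eq_of_le_of_finrank_le hlow (by omega)).symm

omit hp [CharP k p] in
/-- `F^0 = id` on coefficient vectors: `span F^0(N) = N`. [folklore] -/
theorem span_frobVec_zero_image (N : Submodule k (Fin (n + 1) → k)) :
    Submodule.span k (frobVec k p 0 '' (N : Set (Fin (n + 1) → k))) = N := by
  have h0 : frobVec k p 0 '' (N : Set (Fin (n + 1) → k)) = N := by
    have h : (frobVec k p 0 : (Fin (n + 1) → k) → (Fin (n + 1) → k)) = id := by
      funext a j
      simp only [frobVec, pow_zero, pow_one, id]
    rw [h, Set.image_id]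
  rw [h0, Submodule.span_eq]

include p hp in
/-- **A linear form lies in the ideal of the linear forms of `N` iff its coefficient vector lies in `N`.** [folklore] -/
theorem linForm_mem_span_linForm_iff (N : Submodule k (Fin (n + 1) → k)) (a : Fin (n + 1) → k) :
    linForm a ∈ Ideal.span (linForm '' (N : Set (Fin (n + 1) → k))) ↔ a ∈ N := by
  have h := pointForms_span_linForm k p N 0
  rw [span_frobVec_zero_image] at h
  rw [linForm_eq_addForm_zero k p, ← mem_pointForms_iff, h]

/-- **The invariant forms of a linear point**: `(L_B)_j((Σ v_i X_i : v ∈ N)) = span_k F^j(N)` for every `j` (the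
`q`-linear exponent criterion of `MizutaniExponentCriterion` at `e = 0`, and `(L_B)_0 = N`).
[cite: Oda1983HironakaGroupSchemeII, Cor. 2.3 (p. 1171)] -/
theorem invForms_span_linForm (N : Submodule k (Fin (n + 1) → k)) (j : ℕ) :
    invForms k p (Ideal.span (linForm '' (N : Set (Fin (n + 1) → k)))) j =
      Submodule.span k (frobVec k p j '' (N : Set (Fin (n + 1) → k))) := by
  set 𝔩 : Ideal (MvPolynomial (Fin (n + 1)) k) := Ideal.span (linForm '' (N : Set (Fin (n + 1) → k))) with h𝔩
  have hcomap : 𝔩.comap (MvPolynomial.map (iterateFrobenius k p 0)) = 𝔩 := by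
    ext f
    rw [Ideal.mem_comap, iterateFrobenius_zero, MvPolynomial.map_id]
  have hE : ExponentLE k p 𝔩 0 := by
    have h := exponentLE_comap_span_linForm k p N 0
    rwa [hcomap] at h
  have h0 : invForms k p 𝔩 0 = N := by
    ext a
    rw [mem_invForms_zero_iff, ← linForm_eq_addForm_zero k p]
    exact linForm_mem_span_linForm_iff k p N a
  have h := hE j (Nat.zero_le j)
  rw [Nat.sub_zero, h0] at h
  exact h

end Linear

end Summit.ResolutionOfSingularities.KangarooAtlas.Mizutani

end
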